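import Mathlib
import Summits.Ventures.HodgeRepro.Tier4.Common.AdelicDefs
import Summits.Ventures.HodgeRepro.Tier4.Common.AdelicRTF
import Summits.Ventures.HodgeRepro.Tier4.Common.MixedPlaneCusp
import Summits.Ventures.HodgeRepro.Tier4.Common.FundamentalDomainExists
import Summits.Ventures.HodgeRepro.Tier4.Common.RTFDataWitness
import Summits.Ventures.HodgeRepro.Tier4.Line1.RationalPoints
import Summits.Ventures.HodgeRepro.Tier4.Line1.CocompactReduction
import Summits.Ventures.HodgeRepro.Tier4.Line1.SigmaCompactGA

/-!
# Tier4/Common/CocompactBridge — the named cocompactness hypothesis `IsCocompactRational`, its bridges (orbit-cover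
shape; the textbook `CompactSpace (S ⧸ S(k))`), and the `RTFData` witness WITH relatively compact measurable domains
(Line 1's `Setting.ofAdelic` shape `hT : IsCompact (closure R.DT)`)

Blind re-derivation cell `pub-hodge-repro`, Tier 4 (README §9–§10), seat t4-typer-2 (gen 2).  Target tree path
`lean/Summits/Ventures/HodgeRepro/Tier4/Common/CocompactBridge.lean`.

CONTEXT.  The R4 witness of `RTFData` + `IsHaar` is t4-plan-4's `Tier4/Common/RTFDataWitness.lean` (p666745,
`exists_rtfData_isHaar`, CLEARED S12569): Haar measures on the tori, fundamental domains of the rational points of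
positive finite measure, CONDITIONAL on the cocompactness of `T(k)` in `T(𝔸_k)` and of `T′(k)` in `T′(𝔸_k)`, displayed
as `hcc`/`hcc′` in the shape of t4-L1-p5's `Line1.torus_quotient_compact_of_cocompact`.  This module does NOT
re-declare it; it adds, for the consumers:
* `IsCocompactRational W S` — the hypothesis NAMED (one name on both lines, its print locator in the docstring), with
  the conversions `exists_smul_mem` / `of_exists_smul_mem` (orbit-cover shape of `FundamentalDomainExists`) and the
  bridge `of_compactSpace_quotient` from the textbook form «the quotient `S ⧸ S(k)` is compact»;
* `exists_rtfData_isHaar_of_isCocompactRational` — plan-4's witness fed by the named hypothesis (by name);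
* `exists_fundamentalDomain_rationalOf` — for every closed subgroup `S ≤ U(W)(𝔸_k)` that is locally compact and second
  countable and every Haar measure on it: a MEASURABLE fundamental domain of `S(k)` with COMPACT CLOSURE and positive
  finite measure (typer-2 g0's `exists_fundamentalDomain_of_discrete_of_cocompact` + `measure_pos_of_forall_exists_smul_mem`
  on t4-L1-p5's `rationalOf_discrete` / `rationalOf_countable`);
* `exists_rtfData_isHaar_closure` — the witness with the stronger conclusion Line 1's `Setting.ofAdelic` consumes:
  `R.IsHaar ∧ MeasurableSet R.DT ∧ MeasurableSet R.DT' ∧ IsCompact (closure R.DT) ∧ IsCompact (closure R.DT')`,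
  and `exists_rtfData_isHaar_of_compactSpace_quotient`, the same from the textbook hypotheses.

INPUTS BY NAME (one filer per notion, INDEX §0): `Common.FundamentalDomainExists` (p665991), `Common.RTFDataWitness`
(p666745, t4-plan-4), `Line1.RationalPoints` (p662344, `t2Space_GA`), `Line1.CocompactReduction` (p664429,
`rationalOf_discrete`, `rationalOf_countable`), `Line1.SigmaCompactGA` (p665016, `locallyCompact_torusT/T'`,
`secondCountable_torusT/T'`), `Common.AdelicRTF` (`RTFData`), `Common.MixedPlaneCusp` (`RTFData.IsHaar`).

WHAT IS NOT PROVED.  `IsCocompactRational W (torusT W)` itself — the compactness of `T(k)\T(𝔸_k)` for the anisotropic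
torus (Fujisaki; Weil, Basic Number Theory IV §4 Thm 6; Neukirch VI (1.6); t4-lit-5 row 52) — is a theorem of the
literature that no declaration here proves; for junk `PlaneData` (e.g. `P 0 = 1, P 1 = 0`, where `torusT W = U(W)(𝔸_k)`)
it is the Borel–Harish-Chandra statement and may fail.  Every consumer displays it.

Nothing here says anything about the status of the Hodge conjecture for CM abelian varieties, which is NOT proved
(HC_CM is NOT proved by anyone in this repository).
-/

set_option autoImplicit false

noncomputable section

namespace Summit.Ventures.HodgeRepro.Tier4.Common

open NumberField MeasureTheory Topology Set
open scoped Pointwise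

section Cocompact

variable {k : Type} [Field k] [NumberField k] (W : PlaneData k)

/-- **The named hypothesis (d): `S(k)\S(𝔸_k)` is compact**, in the shape «a compact `C ⊆ S` with `S(k) · C = S`»
(t4-L1-p5's `hcc`).  For `S = torusT W` (resp. `torusT' W`) this is the printed compactness of the norm-one idele class
group of the CM extension `E′/k` (Fujisaki; Weil, Basic Number Theory IV §4 Thm 6; Neukirch VI (1.6)) for the two
`U(1)` factors of the torus — a theorem of the literature, displayed, never proved in this repository. -/
def IsCocompactRational (S : Subgroup (GA W)) : Prop :=
  ∃ C : Set S, IsCompact C ∧ ∀ x : S, ∃ γ : rationalOf W S, ∃ c ∈ C, x = (γ : S) * c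

variable {W}

/-- The cover shape of `FundamentalDomainExists`: a compact `C` such that every point of `S` is moved into `C` by a
rational element (`γ⁻¹ • (γ c) = c`). -/
theorem IsCocompactRational.exists_smul_mem {S : Subgroup (GA W)} (h : IsCocompactRational W S) :
    ∃ C : Set S, IsCompact C ∧ ∀ x : S, ∃ γ : rationalOf W S, γ • x ∈ C := by
  obtain ⟨C, hC, hcov⟩ := h
  refine ⟨C, hC, fun x => ?_⟩
  obtain ⟨γ, c, hc, rfl⟩ := hcov x
  refine ⟨γ⁻¹, ?_⟩
  show ((γ⁻¹ : rationalOf W S) : S) * ((γ : S) * c) ∈ C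
  rw [Subgroup.coe_inv, inv_mul_cancel_left]
  exact hc

/-- Conversely, a compact set meeting every orbit gives the `S(k) · C = S` shape (`x = γ (γ⁻¹ x)`). -/
theorem IsCocompactRational.of_exists_smul_mem {S : Subgroup (GA W)} (C : Set S) (hC : IsCompact C)
    (hcov : ∀ x : S, ∃ γ : rationalOf W S, γ • x ∈ C) : IsCocompactRational W S := by
  refine ⟨C, hC, fun x => ?_⟩
  obtain ⟨γ, hγ⟩ := hcov x
  refine ⟨γ⁻¹, (γ : S) * x, hγ, ?_⟩
  rw [Subgroup.coe_inv, inv_mul_cancel_left]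

/-- **The textbook form feeds the named hypothesis**: if `S` is locally compact and the quotient `S ⧸ S(k)` (Mathlib's
quotient by the left cosets `x · S(k)`; `S(k)\S` is its image under `x ↦ x⁻¹`) is compact, then a compact `C` with
`S(k) · C = S` exists: finitely many compact neighbourhoods `K x` have interiors whose images cover the quotient
(`QuotientGroup.isOpenMap_coe`), and `C := (⋃ K x)⁻¹` works — for `y`, `mk c = mk y⁻¹` with `c ∈ K x` gives
`y · c ∈ S(k)`, so `y = (y c) · c⁻¹`. -/
theorem IsCocompactRational.of_compactSpace_quotient (S : Subgroup (GA W)) [LocallyCompactSpace S]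
    (hq : CompactSpace (S ⧸ rationalOf W S)) : IsCocompactRational W S := by
  have hnhds : ∀ x : S, ∃ K : Set S, IsCompact K ∧ x ∈ interior K := fun x => by
    obtain ⟨K, hKc, hK⟩ := exists_compact_mem_nhds x
    exact ⟨K, hKc, mem_interior_iff_mem_nhds.2 hK⟩
  choose K hK hxK using hnhds
  have hopen : ∀ x : S, IsOpen ((QuotientGroup.mk : S → S ⧸ rationalOf W S) '' interior (K x)) := fun x =>
    QuotientGroup.isOpenMap_coe _ isOpen_interior
  have hcover : (Set.univ : Set (S ⧸ rationalOf W S)) ⊆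
      ⋃ x : S, (QuotientGroup.mk : S → S ⧸ rationalOf W S) '' interior (K x) := by
    intro q _
    induction q using QuotientGroup.induction_on with
    | H x => exact Set.mem_iUnion.2 ⟨x, x, hxK x, rfl⟩
  obtain ⟨t, ht⟩ := hq.isCompact_univ.elim_finite_subcover _ hopen hcover
  refine ⟨(⋃ x ∈ t, K x)⁻¹, (t.isCompact_biUnion fun x _ => hK x).inv, fun y => ?_⟩
  have hy := ht (Set.mem_univ (QuotientGroup.mk y⁻¹ : S ⧸ rationalOf W S))
  simp only [Set.mem_iUnion, Set.mem_image, exists_prop] at hy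
  obtain ⟨x, hxt, c, hc, hcy⟩ := hy
  have hmem : c⁻¹ * y⁻¹ ∈ rationalOf W S := QuotientGroup.eq.1 hcy
  refine ⟨⟨(c⁻¹ * y⁻¹)⁻¹, (rationalOf W S).inv_mem hmem⟩, c⁻¹, ?_, ?_⟩
  · rw [Set.mem_inv, inv_inv]
    exact Set.mem_iUnion₂.2 ⟨x, hxt, interior_subset hc⟩
  · show y = (c⁻¹ * y⁻¹)⁻¹ * c⁻¹
    rw [mul_inv_rev, inv_inv, inv_inv, mul_inv_cancel_right]

end Cocompact

section Domain

variable {k : Type} [Field k] [NumberField k] (W : PlaneData k)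

/-- **A relatively compact measurable fundamental domain of `S(k)` in `S`, of positive finite Haar measure**, for every
closed subgroup `S ≤ U(W)(𝔸_k)` that is locally compact and second countable, every Haar measure `μ` on `S`, GIVEN the
named cocompactness (d).  The domain is the one of `FundamentalDomainExists` (`exists_fundamentalDomain_of_discrete_of_cocompact`
on the discrete countable `rationalOf W S` of t4-L1-p5's `CocompactReduction`); `0 < μ D` because `D` meets every
orbit and `μ` is open-positive and left invariant (`measure_pos_of_forall_exists_smul_mem`); `μ D < ⊤` and the compact
closure because `D` lies in a compact set. -/
theorem exists_fundamentalDomain_rationalOf (S : Subgroup (GA W)) [LocallyCompactSpace S]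
    [SecondCountableTopology S] [MeasurableSpace S] [BorelSpace S] (μ : Measure S) [μ.IsHaarMeasure]
    (h : IsCocompactRational W S) :
    ∃ D : Set S, MeasurableSet D ∧ IsFundamentalDomain (rationalOf W S) D μ ∧ IsCompact (closure D) ∧
      0 < μ D ∧ μ D < ⊤ := by
  haveI : T2Space (GA W) := Line1.t2Space_GA W
  haveI : DiscreteTopology (rationalOf W S) := Line1.rationalOf_discrete W S
  haveI : Countable (rationalOf W S) := Line1.rationalOf_countable W S
  obtain ⟨C, hC, hcov⟩ := h.exists_smul_mem
  obtain ⟨D, hDm, hDf, hDu, ⟨L, hL, hDL⟩, hDfin⟩ :=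
    exists_fundamentalDomain_of_discrete_of_cocompact (rationalOf W S) μ C hC hcov
  refine ⟨D, hDm, hDf, ?_, ?_, hDfin⟩
  · exact hL.of_isClosed_subset isClosed_closure (closure_minimal hDL hL.isClosed)
  · exact measure_pos_of_forall_exists_smul_mem (rationalOf W S) μ D fun x => (hDu x).exists

/-- The same for the torus `T`, with the Haar measure and the domain both EXISTENTIAL (Mathlib's `Measure.haar` on the
locally compact `T`). -/
theorem exists_haar_fundamentalDomain_torusT [MeasurableSpace (torusT W)] [BorelSpace (torusT W)]
    (hT : IsCocompactRational W (torusT W)) :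
    ∃ (μT : Measure (torusT W)) (DT : Set (torusT W)), μT.IsHaarMeasure ∧ MeasurableSet DT ∧
      IsFundamentalDomain (rationalOf W (torusT W)) DT μT ∧ IsCompact (closure DT) ∧ 0 < μT DT ∧ μT DT < ⊤ := by
  haveI := Line1.locallyCompact_torusT W
  haveI := Line1.secondCountable_torusT W
  haveI : T2Space (GA W) := Line1.t2Space_GA W
  obtain ⟨D, hDm, hDf, hDc, hDpos, hDfin⟩ :=
    exists_fundamentalDomain_rationalOf W (torusT W) (Measure.haar : Measure (torusT W)) hT
  exact ⟨Measure.haar, D, inferInstance, hDm, hDf, hDc, hDpos, hDfin⟩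

/-- The same for the torus `T′`. -/
theorem exists_haar_fundamentalDomain_torusT' [MeasurableSpace (torusT' W)] [BorelSpace (torusT' W)]
    (hT' : IsCocompactRational W (torusT' W)) :
    ∃ (μT' : Measure (torusT' W)) (DT' : Set (torusT' W)), μT'.IsHaarMeasure ∧ MeasurableSet DT' ∧
      IsFundamentalDomain (rationalOf W (torusT' W)) DT' μT' ∧ IsCompact (closure DT') ∧ 0 < μT' DT' ∧
      μT' DT' < ⊤ := by
  haveI := Line1.locallyCompact_torusT' W
  haveI := Line1.secondCountable_torusT' W
  haveI : T2Space (GA W) := Line1.t2Space_GA W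
  obtain ⟨D, hDm, hDf, hDc, hDpos, hDfin⟩ :=
    exists_fundamentalDomain_rationalOf W (torusT' W) (Measure.haar : Measure (torusT' W)) hT'
  exact ⟨Measure.haar, D, inferInstance, hDm, hDf, hDc, hDpos, hDfin⟩

end Domain

section Witness

variable {k : Type} [Field k] [NumberField k] (W : PlaneData k)

/-- **plan-4's R4 witness fed by the named hypothesis** (`Common.exists_rtfData_isHaar`, RTFDataWitness p666745, by
name): the measurable structures on the tori are the subtype σ-algebras of `[MeasurableSpace (GA W)] [BorelSpace (GA W)]`. -/
theorem exists_rtfData_isHaar_of_isCocompactRational [MeasurableSpace (GA W)] [BorelSpace (GA W)]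
    (chi : torusT W → ℂ) (chi' : torusT' W → ℂ)
    (chi_mul : ∀ s t : torusT W, chi (s * t) = chi s * chi t)
    (chi'_mul : ∀ s t : torusT' W, chi' (s * t) = chi' s * chi' t)
    (chi_rational : ∀ t : torusT W, (t : GA W) ∈ rationalPoints W → chi t = 1)
    (chi'_rational : ∀ t : torusT' W, (t : GA W) ∈ rationalPoints W → chi' t = 1)
    (chi_centre : ∀ (z : GA W) (hz : z ∈ centre W),
      chi ⟨z, centre_le_torusT W hz⟩ = chi' ⟨z, centre_le_torusT' W hz⟩)
    (hT : IsCocompactRational W (torusT W)) (hT' : IsCocompactRational W (torusT' W)) :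
    ∃ R : RTFData W, R.chi = chi ∧ R.chi' = chi' ∧ R.IsHaar :=
  exists_rtfData_isHaar W chi chi' chi_mul chi'_mul chi_rational chi'_rational chi_centre hT hT'

/-- **THE WITNESS WITH RELATIVELY COMPACT MEASURABLE DOMAINS** (Line 1's `Setting.ofAdelic` shape: `R.IsHaar` together
with `hT : IsCompact (closure R.DT)`, `hT' : IsCompact (closure R.DT')`, and the domains measurable).  The measurable
structures on the tori are whatever the caller holds, provided they are Borel (e.g. the subtype σ-algebras of
`[MeasurableSpace (GA W)] [BorelSpace (GA W)]`).  For the characters `χ`, `χ′` (multiplicative, trivial on the rational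
points, agreeing on the centre — the five character fields of `RTFData`) and the two named cocompactness hypotheses, an
`RTFData W` with THOSE characters exists whose torus measures are Haar measures and whose fundamental domains are
measurable, relatively compact, of positive finite measure.  CONDITIONAL on `hT`, `hT'` and on nothing else. -/
theorem exists_rtfData_isHaar_closure [MeasurableSpace (torusT W)] [BorelSpace (torusT W)]
    [MeasurableSpace (torusT' W)] [BorelSpace (torusT' W)]
    (chi : torusT W → ℂ) (chi' : torusT' W → ℂ)
    (chi_mul : ∀ s t : torusT W, chi (s * t) = chi s * chi t)
    (chi'_mul : ∀ s t : torusT' W, chi' (s * t) = chi' s * chi' t)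
    (chi_rational : ∀ t : torusT W, (t : GA W) ∈ rationalPoints W → chi t = 1)
    (chi'_rational : ∀ t : torusT' W, (t : GA W) ∈ rationalPoints W → chi' t = 1)
    (chi_centre : ∀ (z : GA W) (hz : z ∈ centre W),
      chi ⟨z, centre_le_torusT W hz⟩ = chi' ⟨z, centre_le_torusT' W hz⟩)
    (hT : IsCocompactRational W (torusT W)) (hT' : IsCocompactRational W (torusT' W)) :
    ∃ R : RTFData W, R.chi = chi ∧ R.chi' = chi' ∧ R.IsHaar ∧ MeasurableSet R.DT ∧ MeasurableSet R.DT' ∧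
      IsCompact (closure R.DT) ∧ IsCompact (closure R.DT') := by
  obtain ⟨μT, DT, hμT, hDTm, hDTf, hDTc, hDTpos, hDTfin⟩ := exists_haar_fundamentalDomain_torusT W hT
  obtain ⟨μT', DT', hμT', hDT'm, hDT'f, hDT'c, hDT'pos, hDT'fin⟩ := exists_haar_fundamentalDomain_torusT' W hT'
  let R : RTFData W :=
    { chi := chi
      chi' := chi'
      chi_mul := chi_mul
      chi'_mul := chi'_mul
      chi_rational := chi_rational
      chi'_rational := chi'_rational
      chi_centre := chi_centre
      μT := μT
      μT' := μT'
      DT := DT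
      DT' := DT'
      DT_fund := hDTf
      DT'_fund := hDT'f }
  exact ⟨R, rfl, rfl, ⟨hμT, hμT', hDTpos, hDTfin, hDT'pos, hDT'fin⟩, hDTm, hDT'm, hDTc, hDT'c⟩

/-- The same from the TEXTBOOK hypotheses «`T ⧸ T(k)` and `T′ ⧸ T′(k)` are compact» (Mathlib's `CompactSpace` of the
quotient by the left cosets; equivalent to the compactness of `T(k)\T(𝔸_k)` through `x ↦ x⁻¹`). -/
theorem exists_rtfData_isHaar_of_compactSpace_quotient [MeasurableSpace (torusT W)] [BorelSpace (torusT W)]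
    [MeasurableSpace (torusT' W)] [BorelSpace (torusT' W)]
    (chi : torusT W → ℂ) (chi' : torusT' W → ℂ)
    (chi_mul : ∀ s t : torusT W, chi (s * t) = chi s * chi t)
    (chi'_mul : ∀ s t : torusT' W, chi' (s * t) = chi' s * chi' t)
    (chi_rational : ∀ t : torusT W, (t : GA W) ∈ rationalPoints W → chi t = 1)
    (chi'_rational : ∀ t : torusT' W, (t : GA W) ∈ rationalPoints W → chi' t = 1)
    (chi_centre : ∀ (z : GA W) (hz : z ∈ centre W),
      chi ⟨z, centre_le_torusT W hz⟩ = chi' ⟨z, centre_le_torusT' W hz⟩)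
    (hq : CompactSpace (torusT W ⧸ rationalOf W (torusT W)))
    (hq' : CompactSpace (torusT' W ⧸ rationalOf W (torusT' W))) :
    ∃ R : RTFData W, R.chi = chi ∧ R.chi' = chi' ∧ R.IsHaar ∧ MeasurableSet R.DT ∧ MeasurableSet R.DT' ∧
      IsCompact (closure R.DT) ∧ IsCompact (closure R.DT') := by
  haveI := Line1.locallyCompact_torusT W
  haveI := Line1.locallyCompact_torusT' W
  exact exists_rtfData_isHaar_closure W chi chi' chi_mul chi'_mul chi_rational chi'_rational chi_centre
    (IsCocompactRational.of_compactSpace_quotient (torusT W) hq)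
    (IsCocompactRational.of_compactSpace_quotient (torusT' W) hq')

end Witness


end Summit.Ventures.HodgeRepro.Tier4.Common

end
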